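import Summits.BirchSwinnertonDyer.BirchSwinnertonDyer.Theorems.ManinLocalTwoThreeOddUntwistReductions

/-!
# Route `ManinLocalTwoThree`, crux C2 `ManinOddAtFour` (stmt-BirchSwinnertonDyer-22967): RESIDUAL SYNTHESIS across
# the registered lines — the multi-shift-twist certificate need only hold, and the two residuals need only be
# supplied, on the GLOBALLY TWIST-MINIMAL classes (line prover p1, lead integration step; helper)

The two families of landed reductions compose:
* UNTWISTING (seat p2: `maninLocalTwoThree_maninOddAtFour_of_oddUntwistMinimal`): C2 follows from its own
  statement on the optimal curves with `4 ∣ N` whose class admits NO single-prime semistable untwist (dyadic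
  `χ₋₄, χ_{±8}`; odd `χ_{q*}`, `q² ∣ N`).
* EULER-SYSTEM SPLIT (planner es g7, typer T-es-10, seat p1: leaf `KatoShiftTwoLaws`, edges
  `KatoShiftTwoLawsEdges`, step `exists_int_re_multiShiftClass_eq_two_mul`): on the `W[2]`-irreducible locus
  the multi-shift-twist certificate E-es-21 gives `4 ∤ c`, and `2 ∤ c` when `Δ_W < 0`, leaving the typed
  residuals E-es-23 (a) (`Δ_W > 0`: `4 ∤ c ⟹ 2 ∤ c`) and (b) (`W[2]` reducible).
Hence (this file): **C2 ⟸ (certificate on the globally twist-minimal irreducible classes) ∧ (both residuals on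
the globally twist-minimal classes)** — `maninOddAtFour_of_minimalKatoShift_of_minimalResiduals` (hypotheses
inlined, no new definition; the by-name corollaries from `KatoShiftTwistManinTwo` / the `p = 2` Kato fact live
with the `p = 2` lever). The residual leaves `ManinOddOfPosDiscAtFour`, `ManinOddOfReducibleAtFour` are thereby
needed only on their globally twist-minimal parts (census HOME/p1/H2H3-census-globally-twist-minimal-p1.md,
Cremona `N < 5·10⁵`: of the 897 670 optimal curves with `4 ∣ N`, 487 948 (54.4 %) are globally twist-minimal).
HONEST FRAMING: a `proof.conditional` reduction; every certificate / residual input is open (F-es-21 is a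
statement-only fact, E-es-22 a conjecture). Manin's conjecture at `2` is NOT proved here; nothing about BSD is
proved here.
-/

set_option autoImplicit false
set_option linter.dupNamespace false

noncomputable section

open scoped Classical MatrixGroups ModularForm

open CongruenceSubgroup WeierstrassCurve Literature.NumberTheory.EllipticCurves
  Literature.NumberTheory.EllipticCurves.ModularForms

namespace Summit.BirchSwinnertonDyer.BirchSwinnertonDyer.Theorems.ManinLocalTwoThree

section Two

/-- **C2 ⟸ (multi-shift-twist certificate on the globally twist-minimal `W[2]`-irreducible classes: `4 ∤ c`,
and `2 ∤ c` when `Δ_W < 0`) ∧ (archimedean residual `Δ_W > 0`: `4 ∤ c ⟹ 2 ∤ c`, on the globally twist-minimal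
`W[2]`-irreducible classes) ∧ (Manin at `2` on the globally twist-minimal `W[2]`-reducible classes)** — all
three hypotheses quantify only over lattice-optimal data of globally minimal curves with `4 ∣ N` whose class
has no dyadic (`χ₋₄, χ_{±8}`) and no odd (`χ_{q*}`, `q² ∣ N`) semistable untwist; concluding the route decl
`Summit.BirchSwinnertonDyer.BirchSwinnertonDyer.Theses.ManinLocalTwoThree.ManinOddAtFour` BY NAME via
`maninLocalTwoThree_maninOddAtFour_of_oddUntwistMinimal`, excluded middle on irreducibility and the sign of
`Δ_W` (`Δ_W = 0` is impossible: `W.isUnit_Δ`). The first hypothesis is the leaf `KatoShiftTwistManinTwo`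
(E-es-21) restricted; the other two are the leaves `ManinOddOfPosDiscAtFour` / `ManinOddOfReducibleAtFour`
(E-es-23 (a)/(b)) restricted. [cite: Stevens1989, Lemmas (5.2), (5.4)] [cite: Kato2004Asterisque, Thm. 9.7 (p. 189)] -/
theorem maninOddAtFour_of_minimalKatoShift_of_minimalResiduals
    (hA : ∀ (W : WeierstrassCurve ℚ) [W.IsElliptic] [W.IsGloballyMinimal] {N : ℕ} [NeZero N]
      (D : ModularParametrizationData W N),
      (∀ z ∈ D.L.lattice, ∃ w ∈ periodLattice D.f, z = D.c * w) → 2 ^ 2 ∣ N →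
      ¬ (∃ (W' : WeierstrassCurve ℚ) (d : ℤ), W'.IsElliptic ∧ W'.IsGloballyMinimal ∧
        (d = -1 ∨ d = 2 ∨ d = -2) ∧ IsIsogenous W (W'.quadraticTwist (d : ℚ)) ∧
        ¬ 2 ^ 2 ∣ W'.conductorNorm ℤ) →
      ¬ (∃ (W' : WeierstrassCurve ℚ) (q : ℕ), W'.IsElliptic ∧ W'.IsGloballyMinimal ∧
        q.Prime ∧ q ≠ 2 ∧ q ^ 2 ∣ N ∧
        IsIsogenous W (W'.quadraticTwist (((-1 : ℤ) ^ (q / 2) * q : ℤ) : ℚ)) ∧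
        ¬ q ^ 2 ∣ W'.conductorNorm ℤ) →
      W.HasIrreducibleModPGaloisRep 2 → ¬ (4 : ℤ) ∣ D.c ∧ (W.Δ < 0 → ¬ (2 : ℤ) ∣ D.c))
    (hRa : ∀ (W : WeierstrassCurve ℚ) [W.IsElliptic] [W.IsGloballyMinimal] {N : ℕ} [NeZero N]
      (D : ModularParametrizationData W N),
      (∀ z ∈ D.L.lattice, ∃ w ∈ periodLattice D.f, z = D.c * w) → 2 ^ 2 ∣ N →
      ¬ (∃ (W' : WeierstrassCurve ℚ) (d : ℤ), W'.IsElliptic ∧ W'.IsGloballyMinimal ∧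
        (d = -1 ∨ d = 2 ∨ d = -2) ∧ IsIsogenous W (W'.quadraticTwist (d : ℚ)) ∧
        ¬ 2 ^ 2 ∣ W'.conductorNorm ℤ) →
      ¬ (∃ (W' : WeierstrassCurve ℚ) (q : ℕ), W'.IsElliptic ∧ W'.IsGloballyMinimal ∧
        q.Prime ∧ q ≠ 2 ∧ q ^ 2 ∣ N ∧
        IsIsogenous W (W'.quadraticTwist (((-1 : ℤ) ^ (q / 2) * q : ℤ) : ℚ)) ∧
        ¬ q ^ 2 ∣ W'.conductorNorm ℤ) →
      W.HasIrreducibleModPGaloisRep 2 → 0 < W.Δ → ¬ (4 : ℤ) ∣ D.c → ¬ (2 : ℤ) ∣ D.c)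
    (hRb : ∀ (W : WeierstrassCurve ℚ) [W.IsElliptic] [W.IsGloballyMinimal] {N : ℕ} [NeZero N]
      (D : ModularParametrizationData W N),
      (∀ z ∈ D.L.lattice, ∃ w ∈ periodLattice D.f, z = D.c * w) → 2 ^ 2 ∣ N →
      ¬ (∃ (W' : WeierstrassCurve ℚ) (d : ℤ), W'.IsElliptic ∧ W'.IsGloballyMinimal ∧
        (d = -1 ∨ d = 2 ∨ d = -2) ∧ IsIsogenous W (W'.quadraticTwist (d : ℚ)) ∧
        ¬ 2 ^ 2 ∣ W'.conductorNorm ℤ) →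
      ¬ (∃ (W' : WeierstrassCurve ℚ) (q : ℕ), W'.IsElliptic ∧ W'.IsGloballyMinimal ∧
        q.Prime ∧ q ≠ 2 ∧ q ^ 2 ∣ N ∧
        IsIsogenous W (W'.quadraticTwist (((-1 : ℤ) ^ (q / 2) * q : ℤ) : ℚ)) ∧
        ¬ q ^ 2 ∣ W'.conductorNorm ℤ) →
      ¬ W.HasIrreducibleModPGaloisRep 2 → ¬ (2 : ℤ) ∣ D.c) :
    Summit.BirchSwinnertonDyer.BirchSwinnertonDyer.Theses.ManinLocalTwoThree.ManinOddAtFour :=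
  maninLocalTwoThree_maninOddAtFour_of_oddUntwistMinimal
    (fun _hM _hAU _hC _hnf W _ _ N _ D hopt h4 hmin hodd => by
      show ¬ (2 : ℤ) ∣ D.c
      by_cases hirr : W.HasIrreducibleModPGaloisRep 2
      · obtain ⟨h4c, hneg⟩ := hA W D hopt h4 hmin hodd hirr
        rcases lt_trichotomy W.Δ 0 with hlt | heq | hgt
        · exact hneg hlt
        · exact absurd heq W.isUnit_Δ.ne_zero
        · exact hRa W D hopt h4 hmin hodd hirr hgt h4c
      · exact hRb W D hopt h4 hmin hodd hirr)

end Two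

end Summit.BirchSwinnertonDyer.BirchSwinnertonDyer.Theorems.ManinLocalTwoThree

end
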